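import Mathlib
import Summits.KontsevichZagierPeriods.Statement
import Summits.KontsevichZagierPeriods.KontsevichZagierPeriods.Theses.Grothendieck

/-!
# Sketch — crux-ideate round 1, ideator k = 1, crux `gpc_legendre_lemniscatic`
(stmt-KontsevichZagierPeriods-0280, decl `Grothendieck.GpcLegendreLemniscatic`)

First-lemma signatures of the three idea cards (they need not be proved; they must elaborate).
All representations are over `Literature.NumberTheory.Transcendental.KZ.IntegralRep`,
`KZ.Equivalent`, `KZ.of`, `KZ.relations` (KZCalculus.lean).

* card `modulus-band-to-cusp`      — `CuspTransport`, `SlabVanishing`, `CuspFibreIsHalfPi`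
* card `hyperbola-fibration-conic` — `QuarticTwist`, `HyperbolaFibration`, `HalfLineToLine`
* card `cm-quartic-beta-dirichlet` — `QuarticTwist` (shared front end), `BetaTranslationMove`,
                                     `BetaSeparation`
-/

namespace Summit.KontsevichZagierPeriods.KontsevichZagierPeriods.Cruxes.GpcLegendreLemniscatic.SketchK1

open Set Literature.NumberTheory.Transcendental

/-- The open unit square `(0,1)²`, written as in the crux. -/
def sq : Set (Fin 2 → ℝ) := {x | ∀ i, x i ∈ Ioo (0:ℝ) 1}

/-! ### Card A — modulus-band-to-cusp -/

/-- The Legendre family integrand `G_k(x₀,x₁) = e_k(x₀)κ_{k′}(x₁) + e_{k′}(x₀)κ_k(x₁) − κ_k(x₀)κ_{k′}(x₁)`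
(verbatim the integrand of `UnfoldedStokes.LegendreAllModuli`; at `k² = 1/2` it is the crux integrand
`2e(x₀)k(x₁) − k(x₀)k(x₁)`; at `k = 0` it is `1/√(1 − x₁²)`). -/
noncomputable def legendreFamily (k : ℝ) (x : Fin 2 → ℝ) : ℝ :=
  Real.sqrt (1 - k ^ 2 * x 0 ^ 2) / Real.sqrt (1 - x 0 ^ 2) / Real.sqrt ((1 - x 1 ^ 2) * (1 - (1 - k ^ 2) * x 1 ^ 2))
  + Real.sqrt (1 - (1 - k ^ 2) * x 0 ^ 2) / Real.sqrt (1 - x 0 ^ 2) / Real.sqrt ((1 - x 1 ^ 2) * (1 - k ^ 2 * x 1 ^ 2))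
  - 1 / Real.sqrt ((1 - x 0 ^ 2) * (1 - k ^ 2 * x 0 ^ 2)) / Real.sqrt ((1 - x 1 ^ 2) * (1 - (1 - k ^ 2) * x 1 ^ 2))

/-- **A1 CuspTransport** (heart of card A; dimension-preserving). For every real algebraic modulus
`0 < k < 1`, the Legendre family representation `[(0,1)², G_k]` is KZ-equivalent to the CUSP FIBRE
`[(0,1)², 1/√(1 − x₁²)]` (value `π/2`): one Newton–Leibniz move in the modulus coordinate over the
band `0 ≤ t ≤ k` with the family itself as (algebraic) primitive, the Picard–Fuchs exactness
certificate `∂_t G = ∂₀A + ∂₁B + S − S∘swap` on the slab, two Newton–Leibniz moves in `x₀`, `x₁`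
with algebraic primitives vanishing on the faces, and one swap change of variables. -/
def CuspTransport : Prop :=
  ∀ k : ℝ, IsAlgebraic ℚ k → 0 < k → k < 1 →
    ∀ (r r₀ : KZ.IntegralRep 2), r.domain = sq → EqOn r.integrand (legendreFamily k) r.domain →
      r₀.domain = sq → EqOn r₀.integrand (fun x => 1 / Real.sqrt (1 - x 1 ^ 2)) r₀.domain →
      KZ.Equivalent r r₀

/-- **A2 SlabVanishing** (the first checkable stub of card A). The 3-dimensional slab representation
of `∂G/∂k` over `(0,1)² × [0, k₁]` (modulus as LAST coordinate, so that `KZ.newtonLeibnizRel`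
applies verbatim) is a relation: `[slab, ∂_k G] ∈ KZ.relations`. Content: the certificate identity
plus absolute integrability of each of its four pieces on the slab (every piece is
`O(k log(1/k))` in the modulus, kit job j007873). -/
def SlabVanishing : Prop :=
  ∀ k₁ : ℝ, IsAlgebraic ℚ k₁ → 0 < k₁ → k₁ < 1 →
    ∀ (R : KZ.IntegralRep 3),
      R.domain = {z | z 0 ∈ Ioo (0:ℝ) 1 ∧ z 1 ∈ Ioo (0:ℝ) 1 ∧ z 2 ∈ Icc (0:ℝ) k₁} →
      EqOn R.integrand (fun z => deriv (fun t => legendreFamily t ![z 0, z 1]) (z 2)) R.domain →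
      KZ.of R ∈ KZ.relations

/-- **A3 CuspFibreIsHalfPi** (π bookkeeping, shared with the other cards up to its first move):
the cusp fibre `[(0,1)², 1/√(1−x₁²)]` is KZ-equivalent to the crux's right-hand side
`[ℝ, 1/(2(1+x²))]` — Newton–Leibniz in `x₀` (primitive `x₀/√(1−x₁²)`), the rational
parametrisation `x₁ = 2s/(1+s²)`, and the four-piece dissection of `ℝ` by `s ↦ −s`, `s ↦ 1/s`. -/
def CuspFibreIsHalfPi : Prop :=
  ∀ (r₀ : KZ.IntegralRep 2) (r' : KZ.IntegralRep 1), r₀.domain = sq →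
    EqOn r₀.integrand (fun x => 1 / Real.sqrt (1 - x 1 ^ 2)) r₀.domain →
    r'.domain = univ → EqOn r'.integrand (fun x => 1 / (2 * (1 + x 0 ^ 2))) r'.domain →
    KZ.Equivalent r₀ r'

/-- Assembly check of card A at the crux: the three stubs compose to the crux decl
(`k = √(1/2)`: `legendreFamily` specialises pointwise to the crux integrand, as in
`UnfoldedStokes.LegendreGlue`). Stated, not proved here. -/
def CardA_Composes : Prop :=
  CuspTransport → CuspFibreIsHalfPi → Theses.Grothendieck.GpcLegendreLemniscatic

/-! ### Shared CM front end of cards B and C -/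

/-- **QuarticTwist** (cards B, C; two changes of variables). The crux representation
`[(0,1)², 2e(x₀)k(x₁) − k(x₀)k(x₁)]` at `k² = 1/2` is KZ-equivalent to the Fermat-quartic
representation `[(0,1)², 2x₀²/√((1−x₀⁴)(1−x₁⁴))]`: the product substitution
`xᵢ ↦ √2·xᵢ/√(1+xᵢ²)` (McKean–Moll §2.4, `k dt ↦ √2 dx/√(1−x⁴)`, `e dt ↦ √2 dx/((1+x²)√(1−x⁴))`)
followed by the CM involution `x₀ ↦ √((1−x₀²)/(1+x₀²))` of `(0,1)`, which preserves `dx/√(1−x⁴)`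
and exchanges `x² dx/√(1−x⁴)` with `(1−x²)dx/((1+x²)√(1−x⁴))`. -/
def QuarticTwist : Prop :=
  ∀ (r q : KZ.IntegralRep 2), r.domain = sq →
    EqOn r.integrand (fun x => 2 * Real.sqrt (1 - x 0 ^ 2 / 2) / Real.sqrt (1 - x 0 ^ 2) / Real.sqrt ((1 - x 1 ^ 2) * (1 - x 1 ^ 2 / 2)) - 1 / Real.sqrt ((1 - x 0 ^ 2) * (1 - x 0 ^ 2 / 2)) / Real.sqrt ((1 - x 1 ^ 2) * (1 - x 1 ^ 2 / 2))) r.domain →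
    q.domain = sq → EqOn q.integrand (fun x => 2 * x 0 ^ 2 / Real.sqrt ((1 - x 0 ^ 4) * (1 - x 1 ^ 4))) q.domain →
    KZ.Equivalent r q

/-! ### Card C — hyperbola-fibration-conic -/

/-- **C1 HyperbolaFibration** (heart of card C; ONE change of variables, possibly factored in three).
The Fermat-quartic representation `[(0,1)², 2x₀²/√((1−x₀⁴)(1−x₁⁴))]` is KZ-equivalent to the
t-INDEPENDENT representation `[(0,∞) × (0,1), 1/(1+s²)]` ((s,t) with `t` last): the hyperbola
fibration `t = x₀x₁` makes each fibre integral the conic period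
`∫_{t}^{1} 2t² dx/(x√((1−x⁴)(x⁴−t⁴))) = π/2`, rationalised fibrewise by
`w = √((x⁴−t⁴)/(1−x⁴))`, `w = t²s`; the composite map is
`(s,t) ↦ (x₀,x₁) = (t((1+s²)/(1+t⁴s²))^{1/4}, t/x₀)`, a semialgebraic bijection onto the open
square with pulled-back integrand exactly `1/(1+s²)` (kit job j007911). -/
def HyperbolaFibration : Prop :=
  ∀ (q p : KZ.IntegralRep 2), q.domain = sq →
    EqOn q.integrand (fun x => 2 * x 0 ^ 2 / Real.sqrt ((1 - x 0 ^ 4) * (1 - x 1 ^ 4))) q.domain →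
    p.domain = {z | 0 < z 0 ∧ z 1 ∈ Ioo (0:ℝ) 1} → EqOn p.integrand (fun z => 1 / (1 + z 0 ^ 2)) p.domain →
    KZ.Equivalent q p

/-- **C2 HalfLineToLine** (π bookkeeping after the Newton–Leibniz move in `t`):
`[(0,∞) × (0,1), 1/(1+s²)] ~ [ℝ, 1/(2(1+s²))]` — Newton–Leibniz in the last coordinate with the
polynomial primitive `t/(1+s²)`, domain additivity `ℝ = (−∞,0] ∪ (0,∞)`, the reflection `s ↦ −s`,
integrand additivity `h/2 + h/2 = h`. -/
def HalfLineToLine : Prop :=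
  ∀ (p : KZ.IntegralRep 2) (r' : KZ.IntegralRep 1), p.domain = {z | 0 < z 0 ∧ z 1 ∈ Ioo (0:ℝ) 1} →
    EqOn p.integrand (fun z => 1 / (1 + z 0 ^ 2)) p.domain →
    r'.domain = univ → EqOn r'.integrand (fun x => 1 / (2 * (1 + x 0 ^ 2))) r'.domain →
    KZ.Equivalent p r'

/-- Assembly check of card C at the crux. Stated, not proved here. -/
def CardC_Composes : Prop :=
  QuarticTwist → HyperbolaFibration → HalfLineToLine → Theses.Grothendieck.GpcLegendreLemniscatic

/-! ### Card B — cm-quartic-beta-dirichlet -/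

/-- **B1 BetaTranslationMove** (heart of card B; two polynomial changes of variables through ONE
triangle representation). For rational exponents `a, b, c > 0`, Dirichlet's simplex map
`(s, σ) ↦ (u, v) = (sσ, s(1−σ))` (Jacobian `s`) and its mirror `(s, σ) ↦ (s(1−σ)·?, …)` evaluate
`[triangle u,v>0, u+v<1 ; u^{a−1} v^{b−1} (1−u−v)^{c−1}]` in two orders, so the product
representations `B(a+b,c) ⊗ B(a,b)` and `B(b,c) ⊗ B(a,b+c)` on the square are KZ-equivalent:
the rules form of `Γ(p+1) = pΓ(p)`-type (translation) relations among Fermat/Beta periods. -/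
def BetaTranslationMove : Prop :=
  ∀ a b c : ℚ, 0 < a → 0 < b → 0 < c →
    ∀ (r r' : KZ.IntegralRep 2), r.domain = sq →
      EqOn r.integrand (fun x => x 0 ^ ((a : ℝ) + b - 1) * (1 - x 0) ^ ((c : ℝ) - 1) * x 1 ^ ((a : ℝ) - 1) * (1 - x 1) ^ ((b : ℝ) - 1)) r.domain →
      r'.domain = sq →
      EqOn r'.integrand (fun x => x 0 ^ ((b : ℝ) - 1) * (1 - x 0) ^ ((c : ℝ) - 1) * x 1 ^ ((a : ℝ) - 1) * (1 - x 1) ^ ((b : ℝ) + c - 1)) r'.domain →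
      KZ.Equivalent r r'

/-- **B2 BetaSeparation** (the `u = x⁴` substitutions in both coordinates): the Fermat-quartic
representation is KZ-equivalent to `(1/8)·B(3/4,1/2) ⊗ B(1/4,1/2)` written as ONE representation
on the square, `[(0,1)², (1/8) u^{−1/4}(1−u)^{−1/2} v^{−3/4}(1−v)^{−1/2}]` — the instance
`(a,b,c) = (1/4,1/2,1/2)` of `BetaTranslationMove` then gives `(1/8)·B(1/2,1/2) ⊗ B(1/4,1)`,
i.e. `[(0,1)², (1/8) u^{−1/2}(1−u)^{−1/2} v^{−3/4}]`, which one Newton–Leibniz move in `v`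
(primitive `(1/2)v^{1/4}`… algebraic) and the circle bookkeeping turn into `[ℝ, 1/(2(1+x²))]`. -/
def BetaSeparation : Prop :=
  ∀ (q β : KZ.IntegralRep 2), q.domain = sq →
    EqOn q.integrand (fun x => 2 * x 0 ^ 2 / Real.sqrt ((1 - x 0 ^ 4) * (1 - x 1 ^ 4))) q.domain →
    β.domain = sq →
    EqOn β.integrand (fun u => (1 / 8) * u 0 ^ (-(1:ℝ) / 4) * (1 - u 0) ^ (-(1:ℝ) / 2) * u 1 ^ (-(3:ℝ) / 4) * (1 - u 1) ^ (-(1:ℝ) / 2)) β.domain →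
    KZ.Equivalent q β

end Summit.KontsevichZagierPeriods.KontsevichZagierPeriods.Cruxes.GpcLegendreLemniscatic.SketchK1
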